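import Summits.QuantumFields.YangMills.Theorems.BalabanUVNodesN12DirectSurjSharpDelta2
import Literature.MathematicalPhysics.QuantumFieldTheory.Balaban1983to89.Node00.MultiScaleFibreChartCurvatureUniform
import HarnessLib

/-!
# BalabanUVNodes ∕ N12 — THE SHARP FOOTPRINT OF THE CHART CURVATURE: a direction vanishing on the sharp tower of a constrained row charges NO second-derivative component at that row
# (the row-side input of the window-grade (μ) row: which rows `Ψ₂(w,w)` charges)

Cell `pub-ymgap` (HUMAN RULINGS D-0062 ∕ D-0149), WIDTH SEAT `pub-ymgap-dag-n12-w6` g8 (node N12 = [B15]; key K1⁹ `stmt-QuantumFields-27364`, `--kind proof --supports … --as helper`;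
count-neutral).  THEOREMS ONLY (0 `def`, 0 `instance`, 0 `sorry`).  Companion of the (P4)′ support edition `…N12DirectSurjHsurjSupport` (whose clause `hHsupp″` is keyed on the rows CHARGED
by the target `v`): for the (μ) row's datum `v = Ψ₂(w,w)` the charged rows are those whose sharp tower meets `supp w` — this file.  dag-n08-c's p657858 ∕ the Literature lemma
`Node00.fderiv_fderiv_msChart_apply_levelZero` is the level-`0` case (there the component is eventually linear).

WHY.  The `i`-th chart component `Ψ_i(X) = π log(W_{j_i}(c_i)* · Ū^{j_i}(U₀·e^X)(c_i))` reads the fine configuration only on the SHARP TOWER of its row (bonds with both end-point blocks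
among `{c_{i,−}, c_{i,+}}`: iterated two-block locality of (0.4), [III] (2.11)); hence `Ψ_i(X + s·w) = Ψ_i(X)` for EVERY `X` whenever `w` vanishes there, so the derivative field
`X ↦ DΨ_i(X)` is invariant under translation by `w`, and its derivative at `0` in the direction `w` — the curvature slice `D²Ψ_i(0)(w, ·)` — is zero (whether or not `DΨ_i` is
differentiable at `0`: in the other case `fderiv` is `0` by convention).  With the regularity binders (`Ψ` differentiable near `0`, `DΨ` differentiable at `0`) the component of the
`Π`-valued second derivative is that of the component (`Node00.fderiv_fderiv_apply_pi`).

CONTENTS.  §1 ★ `msChart_apply_add_smul_of_vanish_sharp` (translation invariance of a component along a direction vanishing on its sharp tower, at EVERY base point `X`).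
§2 ★★★ `fderiv_fderiv_msChart_apply_eq_zero_of_vanish_sharp` (`(D²Ψ(0)(w, w′))_i = 0`), ★★ `fderiv_fderiv_msChart_apply_ne_zero_imp` (contrapositive, the shape the support clause
`hHsupp″` (b) consumes: `(Ψ₂(w,w′))_i ≠ 0 ⟹ ∃ b₀` in the sharp tower of row `i` with `w b₀ ≠ 0`).

HONEST FRAMING.  Chart calculus by name over landed kernel theorems; nothing of Bałaban's asserted or refuted; N12 NOT discharged; K1⁹ NOT closed; count-neutral (typed 28∕28 · discharged
6∕28 unmoved by this seat); R4 closes only the conditional finite-`𝕋⁴` rung `BalabanLadder.UV`; no summit statement is proved here and NOT the Yang–Mills mass gap (Clay).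
-/

noncomputable section

open scoped BigOperators Matrix.Norms.L2Operator Topology
open Filter

namespace Summit.QuantumFields.YangMills.BalabanUVNodes.N12ChartCurvatureSharpFootprint

open Literature.MathematicalPhysics.QuantumFieldTheory.Balaban1983to89
open Node00 B15DeterminingSets
open T4Continuum (T4Family)
open T4AdjointCovarianceUnitary (lieSU expSU)
open B5Eq118OneStroke (iterBlockOf)
open Summit.QuantumFields.YangMills.BalabanUVNodes.N12DirectSurjSharpDelta2 (avgFamily_congr_sharp)

variable {F : T4Family} {N : ℕ} [NeZero N] {K k : ℕ}

/-! ## §1  Translation invariance of a component along a direction vanishing on its sharp tower -/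

/-- ★ For `w` vanishing on the sharp tower of row `i` (the bonds `b₀` with `B^{j_i}(b₀,±) ∈ {c_{i,−}, c_{i,+}}`), the `i`-th chart component is invariant under translation by `w` at EVERY
base point: `Ψ_{𝐁,W,U₀}(X + s·w) i = Ψ_{𝐁,W,U₀}(X) i` (`U₀·e^{X+s w} = U₀·e^X` on the sharp tower; iterated two-block locality). [cite: Balaban1987RG1, (0.4) p.253; Balaban1988Convergent,
(2.10)–(2.11) p.256; Balaban1985Variational, (82)–(83) p.290] -/
theorem msChart_apply_add_smul_of_vanish_sharp (hk : k ≤ (F.P K).m + (F.P K).K) {𝔹 : DetSet (F.P K)} (W : MSField (F.P K) (SU N)) (U₀ : GaugeField (F.P K) 0 (SU N))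
    (i : Fin (constrCard 𝔹 k)) (w : PBond (F.P K) 0 → lieSU (Fin N))
    (hw : ∀ b₀ : PBond (F.P K) 0,
      (iterBlockOf (((constrEnum 𝔹 k).symm i).1 : ℕ) b₀.src = ((constrEnum 𝔹 k).symm i).2.1.src ∨
        iterBlockOf (((constrEnum 𝔹 k).symm i).1 : ℕ) b₀.src = ((constrEnum 𝔹 k).symm i).2.1.tgt) →
      (iterBlockOf (((constrEnum 𝔹 k).symm i).1 : ℕ) b₀.tgt = ((constrEnum 𝔹 k).symm i).2.1.src ∨
        iterBlockOf (((constrEnum 𝔹 k).symm i).1 : ℕ) b₀.tgt = ((constrEnum 𝔹 k).symm i).2.1.tgt) → w b₀ = 0)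
    (X : PBond (F.P K) 0 → lieSU (Fin N)) (s : ℝ) :
    msChart F N K k 𝔹 W U₀ (X + s • w) i = msChart F N K k 𝔹 W U₀ X i := by
  have hj : (((constrEnum 𝔹 k).symm i).1 : ℕ) ≤ (F.P K).m + (F.P K).K := (Nat.le_of_lt_succ ((constrEnum 𝔹 k).symm i).1.2).trans hk
  have havg : avgFamily (avOfRecord F N K) (expChart U₀ (X + s • w)) _ ((constrEnum 𝔹 k).symm i).2.1
      = avgFamily (avOfRecord F N K) (expChart U₀ X) _ ((constrEnum 𝔹 k).symm i).2.1 :=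
    avgFamily_congr_sharp hj _ fun b₀ hs ht => by
      show U₀ b₀ * expSU ((X + s • w) b₀) = U₀ b₀ * expSU (X b₀)
      rw [Pi.add_apply, Pi.smul_apply, hw b₀ hs ht, smul_zero, add_zero]
  rw [msChart_apply, msChart_apply, relAvg, relAvg, havg]

/-! ## §2  The sharp footprint of the chart curvature -/

/-- ★★★ **THE SHARP FOOTPRINT OF THE CHART CURVATURE.**  For `U₀` with the regularity binders (`Ψ_{𝐁,W,U₀}` differentiable near `0`, `DΨ` differentiable at `0`) and a direction `w`
vanishing on the sharp tower of row `i`: `(D²Ψ(0)(w, w′))_i = 0` for every `w′`.  (By §1 the derivative field `X ↦ D(Ψ_i)(X)` is invariant under translation by `w`, so its derivative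
at `0` along `w` vanishes; the component of the `Π`-valued second derivative is that of the component.) [cite: Balaban1985Variational, (81)–(83) p.290; Balaban1988Convergent, (2.10)–(2.12)
p.256; Balaban1987RG1, (0.4) p.253] -/
theorem fderiv_fderiv_msChart_apply_eq_zero_of_vanish_sharp (hk : k ≤ (F.P K).m + (F.P K).K) {𝔹 : DetSet (F.P K)} {W : MSField (F.P K) (SU N)}
    {U₀ : GaugeField (F.P K) 0 (SU N)}
    (hd : ∀ᶠ X in 𝓝 (0 : PBond (F.P K) 0 → lieSU (Fin N)), DifferentiableAt ℝ (msChart F N K k 𝔹 W U₀) X)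
    (hd2 : DifferentiableAt ℝ (fderiv ℝ (msChart F N K k 𝔹 W U₀)) 0)
    (i : Fin (constrCard 𝔹 k)) (w w' : PBond (F.P K) 0 → lieSU (Fin N))
    (hw : ∀ b₀ : PBond (F.P K) 0,
      (iterBlockOf (((constrEnum 𝔹 k).symm i).1 : ℕ) b₀.src = ((constrEnum 𝔹 k).symm i).2.1.src ∨
        iterBlockOf (((constrEnum 𝔹 k).symm i).1 : ℕ) b₀.src = ((constrEnum 𝔹 k).symm i).2.1.tgt) →
      (iterBlockOf (((constrEnum 𝔹 k).symm i).1 : ℕ) b₀.tgt = ((constrEnum 𝔹 k).symm i).2.1.src ∨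
        iterBlockOf (((constrEnum 𝔹 k).symm i).1 : ℕ) b₀.tgt = ((constrEnum 𝔹 k).symm i).2.1.tgt) → w b₀ = 0) :
    fderiv ℝ (fderiv ℝ (msChart F N K k 𝔹 W U₀)) 0 w w' i = 0 := by
  refine (fderiv_fderiv_apply_pi hd hd2 i w w').trans ?_
  set g : (PBond (F.P K) 0 → lieSU (Fin N)) → lieSU (Fin N) := fun X => msChart F N K k 𝔹 W U₀ X i with hg
  -- translation invariance of `g` and of its derivative field along `w`
  have hgs : ∀ s : ℝ, (fun X => g (X + s • w)) = g := fun s =>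
    funext fun X => msChart_apply_add_smul_of_vanish_sharp hk W U₀ i w hw X s
  have hDs : ∀ (s : ℝ) (X : PBond (F.P K) 0 → lieSU (Fin N)), fderiv ℝ g (X + s • w) = fderiv ℝ g X := fun s X => by
    have h := fderiv_comp_add_right (𝕜 := ℝ) (f := g) (x := X) (s • w)
    rw [hgs s] at h
    exact h.symm
  -- the slice `X ↦ DΨ_i(X) w′` (valued in `𝔰𝔲(N)`): translation invariant along `w`, differentiable at `0` by the chain rule
  set φ : (PBond (F.P K) 0 → lieSU (Fin N)) → lieSU (Fin N) := fun X => fderiv ℝ g X w' with hφ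
  by_cases hh : DifferentiableAt ℝ (fderiv ℝ g) 0
  · have hchain := (ContinuousLinearMap.apply ℝ (lieSU (Fin N)) w').hasFDerivAt.comp (0 : PBond (F.P K) 0 → lieSU (Fin N)) hh.hasFDerivAt
    have hφ' : HasFDerivAt φ ((ContinuousLinearMap.apply ℝ (lieSU (Fin N)) w').comp (fderiv ℝ (fderiv ℝ g) 0)) 0 := hchain
    have hconst : (fun t : ℝ => φ (t • w)) = fun _ => φ 0 := funext fun t => by
      show fderiv ℝ g (t • w) w' = fderiv ℝ g 0 w'
      rw [← zero_add (t • w), hDs t 0]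
    -- along the ray `t ↦ t·w` the slice is constant, so the curvature entry `(D²Ψ_i(0) w) w′` (its velocity) vanishes
    have hray : HasDerivAt (fun t : ℝ => φ (t • w)) (((ContinuousLinearMap.apply ℝ (lieSU (Fin N)) w').comp (fderiv ℝ (fderiv ℝ g) 0)) w) 0 := by
      have h := hφ'.comp_hasDerivAt_of_eq (0 : ℝ) (hasDerivAt_ray w) (zero_smul ℝ w).symm
      exact h
    have h2 : HasDerivAt (fun t : ℝ => φ (t • w)) 0 0 := by
      rw [hconst]
      exact hasDerivAt_const _ _
    exact hray.unique h2
  · have h0 := fderiv_zero_of_not_differentiableAt hh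
    have hz : fderiv ℝ (fderiv ℝ g) 0 w w' = 0 := by
      rw [h0]
      rfl
    exact hz

/-- ★★ **CONTRAPOSITIVE (the shape the support clause `hHsupp″` consumes):** a row charged by the chart curvature on `(w, w′)` has its sharp tower met by `supp w` — `(D²Ψ(0)(w,w′))_i ≠ 0 ⟹
∃ b₀, B^{j_i}(b₀,±) ∈ {c_{i,−}, c_{i,+}} ∧ w b₀ ≠ 0`. [cite: Balaban1985Variational, (81)–(83) p.290; Balaban1988Convergent, (2.10)–(2.12) p.256] -/
theorem fderiv_fderiv_msChart_apply_ne_zero_imp (hk : k ≤ (F.P K).m + (F.P K).K) {𝔹 : DetSet (F.P K)} {W : MSField (F.P K) (SU N)}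
    {U₀ : GaugeField (F.P K) 0 (SU N)}
    (hd : ∀ᶠ X in 𝓝 (0 : PBond (F.P K) 0 → lieSU (Fin N)), DifferentiableAt ℝ (msChart F N K k 𝔹 W U₀) X)
    (hd2 : DifferentiableAt ℝ (fderiv ℝ (msChart F N K k 𝔹 W U₀)) 0)
    (i : Fin (constrCard 𝔹 k)) (w w' : PBond (F.P K) 0 → lieSU (Fin N))
    (hne : fderiv ℝ (fderiv ℝ (msChart F N K k 𝔹 W U₀)) 0 w w' i ≠ 0) :
    ∃ b₀ : PBond (F.P K) 0,
      (iterBlockOf (((constrEnum 𝔹 k).symm i).1 : ℕ) b₀.src = ((constrEnum 𝔹 k).symm i).2.1.src ∨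
        iterBlockOf (((constrEnum 𝔹 k).symm i).1 : ℕ) b₀.src = ((constrEnum 𝔹 k).symm i).2.1.tgt) ∧
      (iterBlockOf (((constrEnum 𝔹 k).symm i).1 : ℕ) b₀.tgt = ((constrEnum 𝔹 k).symm i).2.1.src ∨
        iterBlockOf (((constrEnum 𝔹 k).symm i).1 : ℕ) b₀.tgt = ((constrEnum 𝔹 k).symm i).2.1.tgt) ∧ w b₀ ≠ 0 := by
  by_contra hall
  exact hne (fderiv_fderiv_msChart_apply_eq_zero_of_vanish_sharp hk hd hd2 i w w' fun b₀ hs ht =>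
    not_not.1 fun hb => hall ⟨b₀, hs, ht, hb⟩)

end Summit.QuantumFields.YangMills.BalabanUVNodes.N12ChartCurvatureSharpFootprint

end
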